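import Mathlib
import Literature.Analysis.FunctionSpaces.ContDiffHolderSpace
import Literature.Analysis.FunctionSpaces.ContDiffHolderBilinear
import Literature.Analysis.FunctionSpaces.ContDiffHolderComposition
import Literature.Analysis.FunctionSpaces.ContDiffHolderDiffOperator
import Literature.Analysis.FunctionSpaces.ContDiffHolderFDerivCLM
import Literature.Analysis.FunctionSpaces.ContDiffHolderNemytskii

/-!
# CORE-A of crux `TameOrBrodyR4` (stmt-SmoothPoincare4-7826), line `Sketch`: the nonlinear
# Cauchy–Riemann map in vorticity form as a smooth map of Hölder Banach spaces, and its
# linearisation (lead c6, assembly layer A4)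

Abstract form of the map `𝒢(β, g) = g + χ • R(β, 𝒯 g)` of the line card: the data are members
of the Hölder spaces (the frame `Ψ`, its inverse, the coefficient `A`, the base member `u₀` and
their `y`-derivatives, all cut off to compact support), the almost complex structure `J` (smooth),
a real cut-off `χ`, the constant-section operator `Cβ` and the cut-off Cauchy transform `𝒯`
(bounded `C^{k,r}_b → C^{k+1,r}_b`). We prove

* `CoreA.contDiff_vorticityMap` — `𝒢 : ℂ × C^{k,r}_b → C^{k,r}_b` is `C^∞` (bounded (bi)linear
  algebra of the Hölder library + the Nemytskii theorem `ContDiffHolderFunction.contDiff_compLeft`);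
* `CoreA.hasFDerivAt_vorticityMap_snd` — its partial derivative in `g` at `(0, 0)` is
  `h ↦ h + χ • (S₁ · 𝒯 h)` with the explicit zeroth-order field
  `S₁ = A₁ + Ψinv₁ ∘ (DJ(ũ₀)(Ψ₁ ·))(∂_y u₀)`.

Pure Banach-space calculus; no analysis of `J`-curves happens here.
-/

-- the registered namespace `Summit.SmoothPoincare4.SmoothPoincare4.…` repeats a component
set_option linter.dupNamespace false
set_option maxSynthPendingDepth 3

noncomputable section

open scoped ContDiff Topology NNReal
open Filter Set Function Literature.Analysis.FunctionSpaces

namespace Summit.SmoothPoincare4.SmoothPoincare4.Cruxes.TameOrBrodyR4.Sketch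

namespace CoreA

/-- Local notation for the model space `ℝ⁴ = EuclideanSpace ℝ (Fin 4)`. -/
local notation "E4" => EuclideanSpace ℝ (Fin 4)
/-- Local notation for the complex model plane `ℂ²`. -/
local notation "F2" => ℂ × ℂ

variable {k : ℕ} {r : ℝ≥0} (hr : r ≤ 1)

/-! ### Pointwise pairings as bounded bilinear operators of Hölder spaces -/

/-- Pointwise application of an operator-valued member to a vector-valued member:
`(app F v) x = F x (v x)`. -/
def app {V W : Type} [NormedAddCommGroup V] [NormedSpace ℝ V] [NormedAddCommGroup W]
    [NormedSpace ℝ W] :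
    ContDiffHolderFunction ℂ (V →L[ℝ] W) k r →L[ℝ] ContDiffHolderFunction ℂ V k r →L[ℝ]
      ContDiffHolderFunction ℂ W k r :=
  ContDiffHolderFunction.bilinearCLM hr (ContinuousLinearMap.id ℝ (V →L[ℝ] W))

/-- Pointwise formula for `app`. -/
@[simp]
theorem app_apply {V W : Type} [NormedAddCommGroup V] [NormedSpace ℝ V] [NormedAddCommGroup W]
    [NormedSpace ℝ W] (F : ContDiffHolderFunction ℂ (V →L[ℝ] W) k r)
    (v : ContDiffHolderFunction ℂ V k r) (x : ℂ) : app hr F v x = F x (v x) := rfl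

/-- Pointwise composition of two operator-valued members: `(cmp F G) x = F x ∘L G x`. -/
def cmp {U V W : Type} [NormedAddCommGroup U] [NormedSpace ℝ U] [NormedAddCommGroup V]
    [NormedSpace ℝ V] [NormedAddCommGroup W] [NormedSpace ℝ W] :
    ContDiffHolderFunction ℂ (V →L[ℝ] W) k r →L[ℝ] ContDiffHolderFunction ℂ (U →L[ℝ] V) k r →L[ℝ]
      ContDiffHolderFunction ℂ (U →L[ℝ] W) k r :=
  ContDiffHolderFunction.bilinearCLM hr (ContinuousLinearMap.compL ℝ U V W)

/-- Pointwise formula for `cmp`. -/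
@[simp]
theorem cmp_apply {U V W : Type} [NormedAddCommGroup U] [NormedSpace ℝ U] [NormedAddCommGroup V]
    [NormedSpace ℝ V] [NormedAddCommGroup W] [NormedSpace ℝ W]
    (F : ContDiffHolderFunction ℂ (V →L[ℝ] W) k r) (G : ContDiffHolderFunction ℂ (U →L[ℝ] V) k r)
    (x : ℂ) : cmp hr F G x = (F x).comp (G x) := rfl

/-- Pointwise "flip-evaluation": for a member `T` with values in `E4 →L (E4 →L E4)` and a
vector-valued member `v`, `(flipEval T v) x = (y ↦ T x y (v x))`. -/
def flipEval :
    ContDiffHolderFunction ℂ (E4 →L[ℝ] E4 →L[ℝ] E4) k r →L[ℝ] ContDiffHolderFunction ℂ E4 k r →L[ℝ]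
      ContDiffHolderFunction ℂ (E4 →L[ℝ] E4) k r :=
  ContDiffHolderFunction.bilinearCLM hr
    ((ContinuousLinearMap.flipₗᵢ ℝ E4 E4 E4 : (E4 →L[ℝ] E4 →L[ℝ] E4) →L[ℝ] E4 →L[ℝ] E4 →L[ℝ] E4))

/-- Pointwise formula for `flipEval`. -/
@[simp]
theorem flipEval_apply (T : ContDiffHolderFunction ℂ (E4 →L[ℝ] E4 →L[ℝ] E4) k r)
    (v : ContDiffHolderFunction ℂ E4 k r) (x : ℂ) (y : E4) :
    flipEval hr T v x y = T x y (v x) := rfl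

/-! ### The data of the vorticity map and the map itself -/

/-- **The data of the vorticity-form nonlinear Cauchy–Riemann map** at Hölder order `k`: the
cut-off smooth coefficient fields as members of the Hölder spaces, the smooth structure `J`, the
cut-off `χ`, the constant-section operator and the cut-off Cauchy transform. -/
structure VorticityData (k : ℕ) (r : ℝ≥0) where
  /-- the almost complex structure -/
  J : E4 → E4 →L[ℝ] E4
  /-- smoothness of `J` -/
  hJ : ContDiff ℝ ∞ J
  /-- `½ χ₁ A`, `A = Ψ⁻¹(∂ₓΨ + J(u₀)∂_yΨ)` -/
  A₁ : ContDiffHolderFunction ℂ (F2 →L[ℝ] F2) k r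
  /-- `χ₁ Ψ` and `χ₁ ∂_yΨ` -/
  Ψ₁ : ContDiffHolderFunction ℂ (F2 →L[ℝ] E4) k r
  /-- `χ₁ ∂_yΨ` -/
  dyΨ₁ : ContDiffHolderFunction ℂ (F2 →L[ℝ] E4) k r
  /-- `½ χ₁ Ψ⁻¹` -/
  Ψinv₁ : ContDiffHolderFunction ℂ (E4 →L[ℝ] F2) k r
  /-- `χ₁ u₀` and `χ₁ ∂_y u₀` -/
  u₁ : ContDiffHolderFunction ℂ E4 k r
  /-- `χ₁ ∂_y u₀` -/
  dyu₁ : ContDiffHolderFunction ℂ E4 k r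
  /-- the inner cut-off `χ` -/
  χ : ℂ → ℝ
  /-- smoothness of `χ` -/
  hχ : ContDiff ℝ ∞ χ
  /-- compact support of `χ` -/
  hχs : HasCompactSupport χ
  /-- constant sections `β ↦ (0, β)` in `C^{k+1,r}_b` -/
  Cβ : ℂ →L[ℝ] ContDiffHolderFunction ℂ F2 (k + 1) r
  /-- the cut-off Cauchy transform -/
  𝒯 : ContDiffHolderFunction ℂ F2 k r →L[ℝ] ContDiffHolderFunction ℂ F2 (k + 1) r

namespace VorticityData

variable (D : VorticityData k r)

/-- `J` restricted to order `k + 1`. -/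
theorem hJk : ContDiff ℝ (k + 1) D.J := D.hJ.of_le (by exact_mod_cast le_top)

/-- `W(β, g) = c_β + 𝒯 g ∈ C^{k+1,r}_b` (a continuous linear map of the pair). -/
def W : ℂ × ContDiffHolderFunction ℂ F2 k r →L[ℝ] ContDiffHolderFunction ℂ F2 (k + 1) r :=
  D.Cβ.comp (ContinuousLinearMap.fst ℝ ℂ _) + D.𝒯.comp (ContinuousLinearMap.snd ℝ ℂ _)

/-- Formula for `W`. -/
@[simp] theorem W_apply (p : ℂ × ContDiffHolderFunction ℂ F2 k r) : D.W p = D.Cβ p.1 + D.𝒯 p.2 := rfl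

/-- `V₀(β, g) = W(β, g)` read in `C^{k,r}_b`. -/
def V₀ : ℂ × ContDiffHolderFunction ℂ F2 k r →L[ℝ] ContDiffHolderFunction ℂ F2 k r :=
  (ContDiffHolderFunction.inclCLM hr).comp D.W

/-- `V₁(β, g) = ∂_y W(β, g) ∈ C^{k,r}_b`. -/
def V₁ : ℂ × ContDiffHolderFunction ℂ F2 k r →L[ℝ] ContDiffHolderFunction ℂ F2 k r :=
  (ContDiffHolderFunction.fderivApplyCLM Complex.I).comp D.W

/-- The Nemytskii difference `v ↦ J ∘ (u₁ + Ψ₁ v) - J ∘ u₁`. -/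
def N (v : ContDiffHolderFunction ℂ F2 k r) : ContDiffHolderFunction ℂ (E4 →L[ℝ] E4) k r :=
  ContDiffHolderFunction.compLeft hr D.J D.hJk (D.u₁ + app hr D.Ψ₁ v) -
    ContDiffHolderFunction.compLeft hr D.J D.hJk D.u₁

/-- The inner smooth map `Φ(v₀, v₁) = A₁ v₀ + Ψinv₁ ((J(u₁ + Ψ₁ v₀) - J u₁)(dyu₁ + dyΨ₁ v₀ + Ψ₁ v₁))`. -/
def Φ (q : ContDiffHolderFunction ℂ F2 k r × ContDiffHolderFunction ℂ F2 k r) :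
    ContDiffHolderFunction ℂ F2 k r :=
  app hr D.A₁ q.1 +
    app hr D.Ψinv₁ (app hr (D.N hr q.1) (D.dyu₁ + app hr D.dyΨ₁ q.1 + app hr D.Ψ₁ q.2))

/-- **The vorticity-form nonlinear Cauchy–Riemann map** `𝒢(β, g) = g + χ • Φ(V₀(β,g), V₁(β,g))`. -/
def G (p : ℂ × ContDiffHolderFunction ℂ F2 k r) : ContDiffHolderFunction ℂ F2 k r :=
  p.2 + ContDiffHolderFunction.coeffCLM hr D.χ D.hχ D.hχs (D.Φ hr (D.V₀ hr p, D.V₁ p))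

/-- `𝒢` vanishes at the origin. -/
@[simp] theorem G_zero : D.G hr (0, 0) = 0 := by
  simp [G, Φ, N, V₀, V₁]

/-- The zeroth-order field of the linearisation:
`S₁ = A₁ + Ψinv₁ ∘ (y ↦ DJ(u₁)(y)(dyu₁)) ∘ Ψ₁`. -/
def S₁ : ContDiffHolderFunction ℂ (F2 →L[ℝ] F2) k r :=
  D.A₁ + cmp hr D.Ψinv₁ (cmp hr (flipEval hr
    (ContDiffHolderFunction.compLeft hr (fderiv ℝ D.J)
      ((D.hJ.fderiv_right (m := ∞) le_rfl).of_le (by exact_mod_cast le_top)) D.u₁) D.dyu₁) D.Ψ₁)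

/-- The linearisation in `g` at `(0,0)`: `h ↦ h + χ • (S₁ · 𝒯 h)` (as a continuous linear map). -/
def L : ContDiffHolderFunction ℂ F2 k r →L[ℝ] ContDiffHolderFunction ℂ F2 k r :=
  1 + (ContDiffHolderFunction.coeffCLM hr D.χ D.hχ D.hχs).comp
    ((app hr (D.S₁ hr)).comp ((ContDiffHolderFunction.inclCLM hr).comp D.𝒯))

/-- Formula for `L`. -/
@[simp] theorem L_apply (h : ContDiffHolderFunction ℂ F2 k r) :
    D.L hr h = h + ContDiffHolderFunction.coeffCLM hr D.χ D.hχ D.hχs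
      (app hr (D.S₁ hr) (ContDiffHolderFunction.inclCLM hr (D.𝒯 h))) := rfl

/-! ### Smoothness -/

/-- `N` is `C^∞`. -/
theorem contDiff_N : ContDiff ℝ ∞ (D.N hr) := by
  unfold N
  refine ContDiff.sub ?_ contDiff_const
  exact (ContDiffHolderFunction.contDiff_compLeft hr D.J D.hJ).1.comp
    (contDiff_const.add (app hr D.Ψ₁).contDiff)

/-- `Φ` is `C^∞`. -/
theorem contDiff_Φ : ContDiff ℝ ∞ (D.Φ hr) := by
  unfold Φ
  have happ : ContDiff ℝ ∞ (fun q : ContDiffHolderFunction ℂ (E4 →L[ℝ] E4) k r ×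
      ContDiffHolderFunction ℂ E4 k r => app hr q.1 q.2) :=
    (app (k := k) (r := r) hr (V := E4) (W := E4)).isBoundedBilinearMap.contDiff
  refine ((app hr D.A₁).contDiff.comp contDiff_fst).add ?_
  refine (app hr D.Ψinv₁).contDiff.comp ?_
  refine happ.comp (ContDiff.prodMk ?_ ?_)
  · exact (D.contDiff_N hr).comp contDiff_fst
  · exact (contDiff_const.add ((app hr D.dyΨ₁).contDiff.comp contDiff_fst)).add
      ((app hr D.Ψ₁).contDiff.comp contDiff_snd)

/-- **`𝒢` is `C^∞`.** -/
theorem contDiff_G : ContDiff ℝ ∞ (D.G hr) := by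
  unfold G
  refine contDiff_snd.add ?_
  refine (ContDiffHolderFunction.coeffCLM hr D.χ D.hχ D.hχs).contDiff.comp ?_
  exact (D.contDiff_Φ hr).comp ((D.V₀ hr).contDiff.prodMk (D.V₁).contDiff)

/-! ### The linearisation at the origin -/

/-- Derivative of `N` at `0`: `η ↦ DJ(u₁)(Ψ₁ η)`. -/
theorem hasFDerivAt_N_zero :
    HasFDerivAt (D.N hr)
      ((app hr (ContDiffHolderFunction.compLeft hr (fderiv ℝ D.J)
        ((D.hJ.fderiv_right (m := ∞) le_rfl).of_le (by exact_mod_cast le_top)) D.u₁)).comp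
        (app hr D.Ψ₁)) 0 := by
  unfold N
  have h1 := ContDiffHolderFunction.hasFDerivAt_compLeft hr D.J D.hJ (D.u₁ + app hr D.Ψ₁ 0)
  have h0 : D.u₁ + app hr D.Ψ₁ 0 = D.u₁ := by simp
  have h2 : HasFDerivAt (fun v : ContDiffHolderFunction ℂ F2 k r => D.u₁ + app hr D.Ψ₁ v)
      (app hr D.Ψ₁) 0 := ((app hr D.Ψ₁).hasFDerivAt).const_add D.u₁
  have h3 := (h1.comp (0 : ContDiffHolderFunction ℂ F2 k r) h2).sub_const
    (ContDiffHolderFunction.compLeft hr D.J D.hJk D.u₁)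
  rw [h0] at h3
  exact h3

/-- Derivative of `Φ` at `(0, 0)`: only the `A₁`-term and the linearised Nemytskii term against
`dyu₁` survive (`N 0 = 0`). -/
theorem hasFDerivAt_Φ_zero :
    HasFDerivAt (D.Φ hr) ((app hr (D.S₁ hr)).comp (ContinuousLinearMap.fst ℝ _ _)) (0, 0) := by
  -- notation for the pieces
  set DJu : ContDiffHolderFunction ℂ (E4 →L[ℝ] E4 →L[ℝ] E4) k r :=
    ContDiffHolderFunction.compLeft hr (fderiv ℝ D.J)
      ((D.hJ.fderiv_right (m := ∞) le_rfl).of_le (by exact_mod_cast le_top)) D.u₁ with hDJu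
  have hN0 : D.N hr 0 = 0 := by simp [N]
  -- the bilinear pairing `app` as a bounded bilinear map
  have hB : IsBoundedBilinearMap ℝ (fun q : ContDiffHolderFunction ℂ (E4 →L[ℝ] E4) k r ×
      ContDiffHolderFunction ℂ E4 k r => app hr q.1 q.2) :=
    (app (k := k) (r := r) hr (V := E4) (W := E4)).isBoundedBilinearMap
  -- derivative of `q ↦ (N q.1, dyu₁ + dyΨ₁ q.1 + Ψ₁ q.2)` at `(0,0)`
  have hN' : HasFDerivAt (fun q : ContDiffHolderFunction ℂ F2 k r × ContDiffHolderFunction ℂ F2 k r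
      => D.N hr q.1) (((app hr DJu).comp (app hr D.Ψ₁)).comp (ContinuousLinearMap.fst ℝ _ _))
      (0, 0) :=
    by
      have hf : HasFDerivAt (fun q : ContDiffHolderFunction ℂ F2 k r ×
          ContDiffHolderFunction ℂ F2 k r => q.1) (ContinuousLinearMap.fst ℝ _ _)
          ((0 : ContDiffHolderFunction ℂ F2 k r), (0 : ContDiffHolderFunction ℂ F2 k r)) :=
        hasFDerivAt_fst
      have hc := HasFDerivAt.comp
        ((0 : ContDiffHolderFunction ℂ F2 k r), (0 : ContDiffHolderFunction ℂ F2 k r))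
        (hg := D.hasFDerivAt_N_zero hr) (hf := hf)
      exact hc
  have hR : HasFDerivAt (fun q : ContDiffHolderFunction ℂ F2 k r × ContDiffHolderFunction ℂ F2 k r
      => D.dyu₁ + app hr D.dyΨ₁ q.1 + app hr D.Ψ₁ q.2)
      ((app hr D.dyΨ₁).comp (ContinuousLinearMap.fst ℝ _ _) +
        (app hr D.Ψ₁).comp (ContinuousLinearMap.snd ℝ _ _)) (0, 0) := by
    have h1 : HasFDerivAt (fun q : ContDiffHolderFunction ℂ F2 k r × ContDiffHolderFunction ℂ F2 k r
        => app hr D.dyΨ₁ q.1) ((app hr D.dyΨ₁).comp (ContinuousLinearMap.fst ℝ _ _)) (0, 0) :=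
      (app hr D.dyΨ₁).hasFDerivAt.comp _ hasFDerivAt_fst
    have h2 : HasFDerivAt (fun q : ContDiffHolderFunction ℂ F2 k r × ContDiffHolderFunction ℂ F2 k r
        => app hr D.Ψ₁ q.2) ((app hr D.Ψ₁).comp (ContinuousLinearMap.snd ℝ _ _)) (0, 0) :=
      (app hr D.Ψ₁).hasFDerivAt.comp _ hasFDerivAt_snd
    exact (h1.const_add D.dyu₁).add h2
  have hpair := hB.hasFDerivAt (D.N hr 0, D.dyu₁ + app hr D.dyΨ₁ 0 + app hr D.Ψ₁ 0)
  have hcomp := hpair.comp (0, 0) (hN'.prodMk hR)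
  -- the outer affine pieces
  have hA : HasFDerivAt (fun q : ContDiffHolderFunction ℂ F2 k r × ContDiffHolderFunction ℂ F2 k r
      => app hr D.A₁ q.1) ((app hr D.A₁).comp (ContinuousLinearMap.fst ℝ _ _)) (0, 0) :=
    (app hr D.A₁).hasFDerivAt.comp _ hasFDerivAt_fst
  have htot := hA.add ((app hr D.Ψinv₁).hasFDerivAt.comp (0, 0) hcomp)
  refine htot.congr_fderiv ?_
  -- identify the derivative with `app S₁ ∘ fst`
  refine ContinuousLinearMap.ext fun q => ContDiffHolderFunction.ext fun x => ?_
  have hR0 : D.dyu₁ + app hr D.dyΨ₁ 0 + app hr D.Ψ₁ 0 = D.dyu₁ := by simp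
  simp only [add_apply, ContinuousLinearMap.comp_apply,
    ContinuousLinearMap.coe_fst', ContinuousLinearMap.coe_snd', ContinuousLinearMap.prod_apply,
    IsBoundedBilinearMap.deriv_apply, hN0, map_zero, add_zero]
  simp [S₁, hDJu]

/-- **The partial derivative of `𝒢` in `g` at `(0, 0)` is `L = 1 + χ • (S₁ · 𝒯 ·)`.** -/
theorem hasFDerivAt_G_snd :
    HasFDerivAt (fun g : ContDiffHolderFunction ℂ F2 k r => D.G hr (0, g)) (D.L hr) 0 := by
  -- `g ↦ (V₀(0,g), V₁(0,g))` is linear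
  have hι : HasFDerivAt (fun g : ContDiffHolderFunction ℂ F2 k r => ((0 : ℂ), g))
      (ContinuousLinearMap.inr ℝ ℂ _) 0 :=
    ((hasFDerivAt_const (0 : ℂ) _).prodMk (hasFDerivAt_id _)).congr_fderiv (by ext g <;> simp)
  have hV : HasFDerivAt (fun g : ContDiffHolderFunction ℂ F2 k r => (D.V₀ hr (0, g), D.V₁ (0, g)))
      (((D.V₀ hr).comp (ContinuousLinearMap.inr ℝ ℂ _)).prod
        ((D.V₁).comp (ContinuousLinearMap.inr ℝ ℂ _))) 0 :=
    ((D.V₀ hr).hasFDerivAt.comp _ hι).prodMk ((D.V₁).hasFDerivAt.comp _ hι)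
  have h00 : (D.V₀ hr (0, 0), D.V₁ (0, 0)) = (0, 0) := by simp [V₀, V₁]
  have hΦ := D.hasFDerivAt_Φ_zero hr
  rw [← h00] at hΦ
  have hc := ((ContDiffHolderFunction.coeffCLM hr D.χ D.hχ D.hχs).hasFDerivAt.comp (0 :
    ContDiffHolderFunction ℂ F2 k r) (hΦ.comp 0 hV))
  have htot := (hasFDerivAt_id (0 : ContDiffHolderFunction ℂ F2 k r)).add hc
  refine htot.congr_fderiv ?_
  refine ContinuousLinearMap.ext fun h => ContDiffHolderFunction.ext fun x => ?_
  simp only [add_apply, ContinuousLinearMap.comp_apply,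
    ContinuousLinearMap.coe_fst', ContinuousLinearMap.prod_apply, ContinuousLinearMap.inr_apply,
    ContinuousLinearMap.id_apply, L_apply]
  congr 2
  apply ContDiffHolderFunction.ext
  intro y
  simp [V₀, W]

end VorticityData

end CoreA

/-- **Registered helper `helper_vorticityMapSmooth`**: the vorticity-form nonlinear
Cauchy–Riemann map of any `VorticityData` is `C^∞` on `ℂ × C^{k,r}_b`, vanishes at the origin,
and its partial derivative in the density at the origin is `L = 1 + χ • (S₁ · 𝒯 ·)`. -/
theorem helper_vorticityMapSmooth {k : ℕ} {r : ℝ≥0} (hr : r ≤ 1) (D : CoreA.VorticityData k r) :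
    ContDiff ℝ ∞ (D.G hr) ∧ D.G hr (0, 0) = 0 ∧
      HasFDerivAt (fun g : ContDiffHolderFunction ℂ (ℂ × ℂ) k r => D.G hr (0, g)) (D.L hr) 0 :=
  ⟨D.contDiff_G hr, D.G_zero hr, D.hasFDerivAt_G_snd hr⟩

end Summit.SmoothPoincare4.SmoothPoincare4.Cruxes.TameOrBrodyR4.Sketch
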